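import Mathlib
import HarnessLib
import Literature.Analysis.FluidPDE.SpaceTimeCalculus
import Summits.NavierStokesRegularity.NavierStokesRegularity.Theorems.PoloidalWindowDoorPoloidalWindowRigiditySparseEnergyPlaneLaw
import Summits.NavierStokesRegularity.NavierStokesRegularity.Theorems.PoloidalWindowDoorPoloidalWindowRigidityClebsch
import Summits.NavierStokesRegularity.NavierStokesRegularity.Theorems.PoloidalWindowDoorPoloidalWindowRigiditySlopeFunctionSource

/-!
# Route `PoloidalWindowDoor`, crux `PoloidalWindowRigidity` (stmt-19708), line `sparse_energy`, rung R2 —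
# time calculus for horizontal means (class profiles) and for a box slope datum

Seat ns-poloidal-K2-p2 g8 (interim LEAD-of-record on 19708; file `--supports`; brick 3a of rung R2 «plane means ⇒ `A ≡ 0`»).
The rung integrates the plane mean of the (TH) scalar law over a time interval; this file supplies the one-variable calculus:

* `isSmoothSpaceTimeOn_of_class` — the route's Type-I class is jointly smooth on the open slab (from joint analyticity);
* `deriv_apply_two`, `continuousOn_timeDeriv_two`, `continuous_timeDeriv_two_slice` — the time derivative of the vertical
  velocity `∂ₜv₂` is the vertical component of `∂ₜv`, jointly continuous, with continuous slices;
* `hasDerivAt_hmean_two` — `d/dt ⟨v₂(t)⟩ = ⟨∂ₜv₂(t)⟩` for every horizontal bump mean (`…HorizontalMean.hmean_hasDerivAt_time`);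
* `continuousOn_hmean_param` — horizontal means of a jointly continuous family are continuous in the parameter (dominated convergence);
* `abs_hmean_apply_le_of_sq` — `|⟨w_k⟩| ≤ δ` when `⟨|w|²⟩ ≤ δ²` (Jensen);
* `continuousOn_boxCoeffs`, `hasDerivAt_boxCoeff_time` — for a datum `μ` analytic on a box `(t₁,t₂) × (z₁,z₂)` and a height
  `ζ ∈ (z₁,z₂)`, the four coefficient functions `s ↦ μ(s,ζ), ∂ₜμ(s,ζ), ∂_zμ(s,ζ), ∂_z²μ(s,ζ)` are continuous on `(t₁,t₂)` and the
  first is differentiable with derivative the second.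

WHAT THIS IS NOT: not a claim about Navier–Stokes regularity — calculus bookkeeping for rung R2 of ONE line (bears_on LADDER-NS N0 via crux 19708).
-/

noncomputable section

-- the summit and its single sub-problem share the name (CONVENTIONS §1), as in every Theorems file
set_option linter.dupNamespace false

namespace Summit.NavierStokesRegularity.NavierStokesRegularity.Theorems.PoloidalWindowDoorPoloidalWindowRigiditySparseEnergyTimeMeans

open MeasureTheory Set Function Filter Topology Metric
open scoped RealInnerProductSpace InnerProductSpace ContDiff
open Literature.Analysis Literature.Analysis.FluidPDE
open Summit.NavierStokesRegularity.NavierStokesRegularity.Theorems.PoloidalWindowDoorPoloidalWindowRigidityHorizontalMean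
open Summit.NavierStokesRegularity.NavierStokesRegularity.Theorems.PoloidalWindowDoorPoloidalWindowRigiditySparseEnergyPlaneLaw
open Summit.NavierStokesRegularity.NavierStokesRegularity.Theorems.LocalSineTubeDoorProfileAlignedWindowRigidityAncient
open Summit.NavierStokesRegularity.NavierStokesRegularity.Theorems.PoloidalWindowDoorPoloidalWindowRigiditySlopeFunctionSource

variable {C : ℝ} {v : ℝ → EuclideanSpace ℝ (Fin 3) → EuclideanSpace ℝ (Fin 3)}

/-! ### Joint smoothness of the class and the time derivative of `v₂` -/

/-- The route's Type-I class is jointly smooth on the open slab `(−∞,0) × ℝ³` (joint analyticity, tree `analyticOnNhd_uncurry`).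
[folklore] -/
theorem isSmoothSpaceTimeOn_of_class (hrate : HasTypeITimeDecay C v)
    (hcont : ContinuousOn (uncurry v) (Iio (0 : ℝ) ×ˢ univ))
    (hmild : ∀ s t : ℝ, s < t → t < 0 → ∀ x,
      v t x = UnboundedOperators.heatExtension (v s) (t - s) x - oseenDuhamel 1 s v v t x) :
    IsSmoothSpaceTimeOn (Iio (0 : ℝ)) v :=
  (analyticOnNhd_uncurry hcont (bdd_of_hasTypeITimeDecay hrate) hmild).contDiffOn_of_completeSpace

/-- `∂ₜ(v₂)(t,x) = (∂ₜv(t,x))₂` on the open slab. [folklore] -/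
theorem deriv_apply_two (hsm : IsSmoothSpaceTimeOn (Iio (0 : ℝ)) v) {t : ℝ} (ht : t < 0) (x : EuclideanSpace ℝ (Fin 3)) :
    deriv (fun s => v s x 2) t = deriv (fun s => v s x) t 2 := by
  have h := hsm.hasDerivAt_timeLine isOpen_Iio ht x
  have h2 := ((EuclideanSpace.proj (2 : Fin 3) : EuclideanSpace ℝ (Fin 3) →L[ℝ] ℝ).hasFDerivAt.comp_hasDerivAt t h).deriv
  exact h2

/-- `(t,x) ↦ ∂ₜv₂(t,x)` is jointly continuous on the open slab. [folklore] -/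
theorem continuousOn_timeDeriv_two (hsm : IsSmoothSpaceTimeOn (Iio (0 : ℝ)) v) :
    ContinuousOn (fun p : ℝ × EuclideanSpace ℝ (Fin 3) => deriv (fun s => v s p.2 2) p.1) (Iio (0 : ℝ) ×ˢ univ) := by
  have h1 : ContinuousOn (uncurry fun t x => deriv (fun s => v s x) t) (Iio (0 : ℝ) ×ˢ univ) :=
    (hsm.isSmoothSpaceTimeOn_deriv isOpen_Iio).continuousOn
  have h2 : ContinuousOn (fun p : ℝ × EuclideanSpace ℝ (Fin 3) => deriv (fun s => v s p.2) p.1 2) (Iio (0 : ℝ) ×ˢ univ) :=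
    (EuclideanSpace.proj (2 : Fin 3)).continuous.comp_continuousOn h1
  refine h2.congr fun p hp => ?_
  exact deriv_apply_two hsm (mem_prod.1 hp).1 p.2

/-- For `t < 0`, the slice `x ↦ ∂ₜv₂(t,x)` is continuous. [folklore] -/
theorem continuous_timeDeriv_two_slice (hsm : IsSmoothSpaceTimeOn (Iio (0 : ℝ)) v) {t : ℝ} (ht : t < 0) :
    Continuous fun x => deriv (fun s => v s x 2) t := by
  have h1 : Continuous fun x => deriv (fun s => v s x) t :=
    ((hsm.isSmoothSpaceTimeOn_deriv isOpen_Iio).contDiff_slice ht).continuous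
  have h2 : Continuous fun x => deriv (fun s => v s x) t 2 := (EuclideanSpace.proj (2 : Fin 3)).continuous.comp h1
  refine h2.congr fun x => ?_
  exact (deriv_apply_two hsm ht x).symm

/-- **`d/dt ⟨v₂(t)⟩ = ⟨∂ₜv₂(t)⟩`** for every horizontal bump mean, `t < 0`. [folklore] -/
theorem hasDerivAt_hmean_two (hsm : IsSmoothSpaceTimeOn (Iio (0 : ℝ)) v)
    (φ : ContDiffBump (0 : EuclideanSpace ℝ (Fin 2))) (c : EuclideanSpace ℝ (Fin 3)) (R z : ℝ) {t : ℝ} (ht : t < 0) :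
    HasDerivAt (fun σ => hmean φ c R z (fun x => v σ x 2)) (hmean φ c R z (fun x => deriv (fun s => v s x 2) t)) t := by
  have hF : ContinuousOn (uncurry fun σ x => v σ x 2) (Iio (0 : ℝ) ×ˢ univ) :=
    (EuclideanSpace.proj (2 : Fin 3)).continuous.comp_continuousOn hsm.continuousOn
  refine hmean_hasDerivAt_time φ c R z isOpen_Iio ht (F := fun σ x => v σ x 2)
    (Ft := fun σ x => deriv (fun s => v s x 2) σ) hF (continuousOn_timeDeriv_two hsm) fun τ hτ x => ?_
  have h := hsm.hasDerivAt_timeLine isOpen_Iio hτ x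
  have h2 := (EuclideanSpace.proj (2 : Fin 3) : EuclideanSpace ℝ (Fin 3) →L[ℝ] ℝ).hasFDerivAt.comp_hasDerivAt τ h
  rw [deriv_apply_two hsm hτ x]
  exact h2

/-! ### Means of a jointly continuous family are continuous in the parameter -/

/-- Horizontal means of a family `G σ` jointly continuous on `S × ℝ³` (`S` open) depend continuously on `σ ∈ S`
(dominated convergence against the compactly supported bump). [folklore] -/
theorem continuousOn_hmean_param (φ : ContDiffBump (0 : EuclideanSpace ℝ (Fin 2))) (c : EuclideanSpace ℝ (Fin 3)) (R z : ℝ)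
    {S : Set ℝ} (hS : IsOpen S) {G : ℝ → EuclideanSpace ℝ (Fin 3) → ℝ} (hG : ContinuousOn (uncurry G) (S ×ˢ univ)) :
    ContinuousOn (fun σ => hmean φ c R z (G σ)) S := by
  intro σ₀ hσ₀
  refine ContinuousAt.continuousWithinAt ?_
  -- a compact time window around `σ₀` inside `S`
  obtain ⟨r, hr, hrS⟩ := Metric.isOpen_iff.1 hS σ₀ hσ₀
  have hIcc : Icc (σ₀ - r / 2) (σ₀ + r / 2) ⊆ S := fun σ hσ => hrS (by
    rw [Metric.mem_ball, Real.dist_eq, abs_lt]; constructor <;> linarith [hσ.1, hσ.2])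
  -- the integrand is bounded on the compact set `window × pt(closed disc)`
  set Kset : Set (ℝ × EuclideanSpace ℝ (Fin 3)) :=
    Icc (σ₀ - r / 2) (σ₀ + r / 2) ×ˢ (pt c R z '' closedBall (0 : EuclideanSpace ℝ (Fin 2)) φ.rOut) with hKset
  have hKc : IsCompact Kset := isCompact_Icc.prod ((isCompact_closedBall _ _).image (continuous_pt c R z))
  have hKS : Kset ⊆ S ×ˢ univ := prod_mono hIcc (subset_univ _)
  obtain ⟨B, hB⟩ := hKc.exists_bound_of_continuousOn (hG.mono hKS)
  have hB0 : 0 ≤ B := le_trans (norm_nonneg _) (hB (σ₀, pt c R z 0)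
    (mk_mem_prod ⟨by linarith, by linarith⟩ ⟨0, mem_closedBall_self φ.rOut_pos.le, rfl⟩))
  -- slices are continuous for `σ ∈ S`
  have hslice : ∀ σ ∈ S, Continuous fun y : EuclideanSpace ℝ (Fin 2) => G σ (pt c R z y) * φ.normed volume y := by
    intro σ hσ
    have h1 : Continuous (uncurry G ∘ fun x : EuclideanSpace ℝ (Fin 3) => ((σ, x) : ℝ × EuclideanSpace ℝ (Fin 3))) :=
      hG.comp_continuous (continuous_const.prodMk continuous_id) fun x => mk_mem_prod hσ (mem_univ x)
    have h2 : Continuous fun x : EuclideanSpace ℝ (Fin 3) => G σ x := h1.congr fun x => rfl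
    exact (h2.comp (continuous_pt c R z)).mul φ.continuous_normed
  have hwin : ∀ᶠ σ in 𝓝 σ₀, σ ∈ Icc (σ₀ - r / 2) (σ₀ + r / 2) :=
    Icc_mem_nhds (by linarith) (by linarith)
  unfold hmean
  refine continuousAt_of_dominated (bound := fun y => B * φ.normed volume y) ?_ ?_ ?_ ?_
  · filter_upwards [hwin] with σ hσ
    exact (hslice σ (hIcc hσ)).aestronglyMeasurable
  · filter_upwards [hwin] with σ hσ
    refine ae_of_all _ fun y => ?_
    rw [Real.norm_eq_abs, abs_mul, abs_of_nonneg (φ.nonneg_normed y)]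
    by_cases hy : y ∈ closedBall (0 : EuclideanSpace ℝ (Fin 2)) φ.rOut
    · exact mul_le_mul_of_nonneg_right (hB (σ, pt c R z y) (mk_mem_prod hσ ⟨y, hy, rfl⟩)) (φ.nonneg_normed y)
    · have hzero : φ.normed volume y = 0 := by
        have hy' : y ∉ tsupport (φ.normed volume) := by rw [φ.tsupport_normed_eq]; exact hy
        exact image_eq_zero_of_notMem_tsupport hy'
      rw [hzero, mul_zero, mul_zero]
  · exact (integrable_mul_normed φ continuous_const : Integrable fun y => B * φ.normed volume y)
  · refine ae_of_all _ fun y => ?_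
    have hpt : ContinuousAt (uncurry G) (σ₀, pt c R z y) :=
      (hG.continuousAt ((hS.prod isOpen_univ).mem_nhds (mk_mem_prod hσ₀ (mem_univ _))))
    have hf : ContinuousAt (fun σ : ℝ => ((σ, pt c R z y) : ℝ × EuclideanSpace ℝ (Fin 3))) σ₀ :=
      (continuous_id.prodMk continuous_const).continuousAt
    have h1 : ContinuousAt (fun σ => G σ (pt c R z y)) σ₀ :=
      ContinuousAt.comp (g := uncurry G) (f := fun σ : ℝ => ((σ, pt c R z y) : ℝ × EuclideanSpace ℝ (Fin 3))) hpt hf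
    exact h1.mul continuousAt_const

/-! ### Jensen for a component -/

/-- `|⟨w_k⟩| ≤ δ` when `⟨|w|²⟩ ≤ δ²`. [folklore] -/
theorem abs_hmean_apply_le_of_sq (φ : ContDiffBump (0 : EuclideanSpace ℝ (Fin 2))) (c : EuclideanSpace ℝ (Fin 3)) (R z : ℝ)
    {w : EuclideanSpace ℝ (Fin 3) → EuclideanSpace ℝ (Fin 3)} (hw : Continuous w) (k : Fin 3) {δ : ℝ} (hδ : 0 ≤ δ)
    (h : hmean φ c R z (fun x => ‖w x‖ ^ 2) ≤ δ ^ 2) : |hmean φ c R z (fun x => w x k)| ≤ δ := by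
  have hk : Continuous fun x => w x k := (EuclideanSpace.proj k).continuous.comp hw
  have h1 := abs_hmean_mul_le φ c R z (F := fun _ => (1 : ℝ)) (G := fun x => w x k) continuous_const hk
    (M := 1) (fun _ => by simp)
  simp only [mul_one, one_mul] at h1
  exact h1.trans (hmean_abs_apply_le φ c R z hw k hδ h)

/-! ### Coefficients of a box datum along a fixed height -/

variable {μ : ℝ → ℝ → ℝ} {t₁ t₂ z₁ z₂ ζ : ℝ}

/-- For `μ` analytic on the box `(t₁,t₂) × (z₁,z₂)` and `ζ ∈ (z₁,z₂)`: `s ↦ μ(s,ζ)` is differentiable on `(t₁,t₂)` with derivative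
`s ↦ ∂ₜμ(s,ζ)`. [folklore] -/
theorem hasDerivAt_boxCoeff_time (hμ : ∀ q ∈ Ioo t₁ t₂ ×ˢ Ioo z₁ z₂, AnalyticAt ℝ (uncurry μ) q) (hζ : ζ ∈ Ioo z₁ z₂)
    {s : ℝ} (hs : s ∈ Ioo t₁ t₂) : HasDerivAt (fun σ => μ σ ζ) (deriv (fun σ => μ σ ζ) s) s :=
  ((hasDerivAt_slices_of_uncurry (p := (s, ζ)) (hμ _ (mk_mem_prod hs hζ)).differentiableAt).2).differentiableAt.hasDerivAt

/-- **Continuity of the four coefficient functions** `s ↦ μ(s,ζ), ∂ₜμ(s,ζ), ∂_zμ(s,ζ), ∂_z²μ(s,ζ)` on `(t₁,t₂)`, for `μ` analytic on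
the box and `ζ ∈ (z₁,z₂)`. [folklore] -/
theorem continuousOn_boxCoeffs (hμ : ∀ q ∈ Ioo t₁ t₂ ×ˢ Ioo z₁ z₂, AnalyticAt ℝ (uncurry μ) q) (hζ : ζ ∈ Ioo z₁ z₂) :
    ContinuousOn (fun s => μ s ζ) (Ioo t₁ t₂) ∧ ContinuousOn (fun s => deriv (fun σ => μ σ ζ) s) (Ioo t₁ t₂) ∧
      ContinuousOn (fun s => deriv (μ s) ζ) (Ioo t₁ t₂) ∧ ContinuousOn (fun s => deriv (deriv (μ s)) ζ) (Ioo t₁ t₂) := by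
  set V : Set (ℝ × ℝ) := Ioo t₁ t₂ ×ˢ Ioo z₁ z₂ with hV
  have hVo : IsOpen V := isOpen_Ioo.prod isOpen_Ioo
  have hA : AnalyticOnNhd ℝ (uncurry μ) V := fun q hq => hμ q hq
  have hC : ContDiffOn ℝ ∞ (uncurry μ) V := hA.contDiffOn_of_completeSpace
  set G : ℝ × ℝ → (ℝ × ℝ →L[ℝ] ℝ) := fderiv ℝ (uncurry μ) with hG
  have hGc : ContinuousOn G V := hC.continuousOn_fderiv_of_isOpen hVo (by simp)
  have hGd : ContDiffOn ℝ ∞ (fun q => G q ((0 : ℝ), (1 : ℝ))) V :=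
    (hC.fderiv_of_isOpen hVo (m := ∞) (by simp)).clm_apply contDiffOn_const
  have hline : ContinuousOn (fun s : ℝ => ((s, ζ) : ℝ × ℝ)) (Ioo t₁ t₂) := (continuous_id.prodMk continuous_const).continuousOn
  have hmaps : MapsTo (fun s : ℝ => ((s, ζ) : ℝ × ℝ)) (Ioo t₁ t₂) V := fun s hs => mk_mem_prod hs hζ
  refine ⟨?_, ?_, ?_, ?_⟩
  · exact hC.continuousOn.comp hline hmaps
  · have h1 : ContinuousOn (fun s => G (s, ζ) ((1 : ℝ), (0 : ℝ))) (Ioo t₁ t₂) := (hGc.comp hline hmaps).clm_apply continuousOn_const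
    refine h1.congr fun s hs => ?_
    exact (hasDerivAt_slices_of_uncurry (p := (s, ζ)) (hA _ (hmaps hs)).differentiableAt).2.deriv
  · have h1 : ContinuousOn (fun s => G (s, ζ) ((0 : ℝ), (1 : ℝ))) (Ioo t₁ t₂) := (hGc.comp hline hmaps).clm_apply continuousOn_const
    refine h1.congr fun s hs => ?_
    exact (hasDerivAt_slices_of_uncurry (p := (s, ζ)) (hA _ (hmaps hs)).differentiableAt).1.deriv
  · -- `∂_z²μ(s,ζ) = D(q ↦ Dμ(q)(0,1))(s,ζ)(0,1)`
    have hH : ContinuousOn (fderiv ℝ (fun q => G q ((0 : ℝ), (1 : ℝ)))) V := hGd.continuousOn_fderiv_of_isOpen hVo (by simp)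
    have h1 : ContinuousOn (fun s => fderiv ℝ (fun q => G q ((0 : ℝ), (1 : ℝ))) (s, ζ) ((0 : ℝ), (1 : ℝ))) (Ioo t₁ t₂) :=
      (hH.comp hline hmaps).clm_apply continuousOn_const
    refine h1.congr fun s hs => ?_
    -- near `ζ`, `deriv (μ s)` is the slice `c ↦ G (s,c) (0,1)`
    have hev : deriv (μ s) =ᶠ[𝓝 ζ] fun c' => G (s, c') ((0 : ℝ), (1 : ℝ)) := by
      have hc : ContinuousAt (fun c' : ℝ => ((s, c') : ℝ × ℝ)) ζ := by fun_prop
      filter_upwards [hc.preimage_mem_nhds (hVo.mem_nhds (hmaps hs))] with c' hc'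
      exact (hasDerivAt_slices_of_uncurry (p := (s, c')) (hA _ hc').differentiableAt).1.deriv
    show deriv (deriv (μ s)) ζ = fderiv ℝ (fun q => G q ((0 : ℝ), (1 : ℝ))) (s, ζ) ((0 : ℝ), (1 : ℝ))
    rw [hev.deriv_eq]
    have hd : DifferentiableAt ℝ (uncurry fun σ c' => G (σ, c') ((0 : ℝ), (1 : ℝ))) (s, ζ) := by
      have e : (uncurry fun σ c' => G (σ, c') ((0 : ℝ), (1 : ℝ))) = fun q => G q ((0 : ℝ), (1 : ℝ)) := by
        funext q; rcases q with ⟨σ, c'⟩; rfl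
      rw [e]; exact (hGd.contDiffAt (hVo.mem_nhds (hmaps hs))).differentiableAt (by simp)
    have h := (hasDerivAt_slices_of_uncurry (G := fun σ c' => G (σ, c') ((0 : ℝ), (1 : ℝ))) (p := (s, ζ)) hd).1.deriv
    have e : (uncurry fun σ c' => G (σ, c') ((0 : ℝ), (1 : ℝ))) = fun q => G q ((0 : ℝ), (1 : ℝ)) := by
      funext q; rcases q with ⟨σ, c'⟩; rfl
    rw [e] at h
    exact h

end Summit.NavierStokesRegularity.NavierStokesRegularity.Theorems.PoloidalWindowDoorPoloidalWindowRigiditySparseEnergyTimeMeans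

end
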